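import Mathlib
import Summits.QuantumFields.YangMills.Theorems.CoarseStiffnessTailCappedCoarseStiffnessLEdgeBulk
import Summits.QuantumFields.YangMills.Theorems.CoarseStiffnessTailCappedCoarseStiffnessLLargeFieldCountGlue

/-!
# Route `CoarseStiffnessTail` — THE TYPED CRUX FACTORISES EXACTLY INTO ITS EDGE PART AND ITS BULK PART, file 2 of 2:
# `CappedCoarseStiffnessL ⇔ SubThresholdStiffness ∧ UniformLargeFieldCount` (lead's certificate, seat `ym-line-cst-p1` g8; helper on crux
# stmt-QuantumFields-25301)

Continuation of `…EdgeBulk` (pointwise `β·X_j = β·Y_j + p(g)²·N_j`, `∫e^{cβX_j} ≤ ½∫e^{2cβY_j} + ½∫e^{2cp²N_j}`).  Statement level, everything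
written out (no `def`), all in the crux's own quantifier block `∀ L b₀ p₀ ∃ c₀ C₀ γ₁ ∀ F γ K j` (constants BEFORE family, coupling, cut-off, height):

  UniformLargeFieldCount := `… ∫ exp(c₀·p(g_{K−j})²·N_j) dGibbs_K ≤ exp(C₀·#Plaq_j)`   (g5's LargeFieldCount with UNIFORM constants and `A = 0`),
  SubThresholdStiffness  := `… ∫ exp(c₀·β_{K−j}·Y_j) dGibbs_K ≤ exp(C₀·#Plaq_j)`,  `Y_j = Σ_a |Ū^j(∂a) − 1|²·1[|Ū^j(∂a) − 1| < θ(K−j)]`.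

* §3 **`uniformLargeFieldCount_of_cappedCoarseStiffnessL`**, **`subThresholdStiffness_of_cappedCoarseStiffnessL`** (same constants, by monotonicity);
  **`cappedCoarseStiffnessL_of_subThreshold_and_uniformCount`** (`c₀ = min/2`, `C₀ = max`, `γ₁ = min`; the `½(e^{2a} + e^{2b})` split);
  **`cappedCoarseStiffnessL_iff_subThreshold_and_uniformCount`**.
* §4 **`largeFieldCount_of_uniformLargeFieldCount`** (⇒ g5's per-`(F, γ)` LargeFieldCount, `A = 0`) and **`historyTailL_of_uniformLargeFieldCount`**
  (⇒ `UnitScaleTilt.HistoryTailL`, 19936, BY NAME via p636229); with g7's `largeFieldCountW_of_largeFieldCount`/`wedgeTailL_of_largeFieldCountW`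
  (p639501) the edge conjunct also gives `HistoryWedge.WedgeTailL` (27959) — not restated here to keep this module off that route's cone.

READING (for planners; nothing here is a claim about Bałaban's estimates).  The typed crux is EXACTLY the conjunction of (1) UniformLargeFieldCount —
joint Peierls bounds for the level-`j` large-field sets at rate `c₀p(g)²` with an `e^{C₀#Plaq_j}` allowance (p635820 §3), the organ's located content
([Balaban1985UV3] (71) p.273 / [Balaban1989LargeFieldII] §0 (0.10)–(0.12) integrated against the Gibbs law; owner v5q `stub_jointRateHigh`) in
uniform all-subfamilies packaging, the ONLY conjunct any consumer of this line reads; and (2) SubThresholdStiffness — joint Gaussian fluctuation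
control of the averaged plaquettes INSIDE the small-field window, large plaquettes uncharged ((5) p.256 two-sided with the positive quadratic form of
the effective action on the small-field domain; card `Lines/birth.md` §Hardest stub items 1–4), read by NO consumer.  Separate mechanisms in the
source (R-operation vs. small-field Gaussian integration), separately registered stubs of the line's skeleton v4; a planner re-typing 25301 to the
count currency drops precisely conjunct (2).

HONEST SCOPE.  Conditional certificates and an equivalence; NOTHING of Bałaban's estimates is proved: both conjuncts at `j ≥ 1`, the crux 25301 and
`HistoryTailL` 19936 stay OPEN; `YM3TorusSU2` (rung R3, a RECORD rung, not the Clay statement) is NOT proved; the Yang–Mills mass gap is NOT touched.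

References: T. Bałaban, CMP **102** (1985) 255–275 [Balaban1985UV3] ((5) p.256, (7) p.257, (70)–(71) p.273); CMP **122** (1989) 355–392
[Balaban1989LargeFieldII] (§0 (0.10)–(0.12)); J. Fröhlich, R. Israel, E. Lieb, B. Simon, CMP **62** (1978) 1–34 [FrohlichIsraelLiebSimon1978] (Thm 4.1).
-/

noncomputable section

namespace Summit.QuantumFields.YangMills.Theorems.CoarseStiffnessTailEdgeBulkFactorisation

open MeasureTheory ProbabilityTheory Finset
open Literature.MathematicalPhysics.QuantumFieldTheory
open Literature.MathematicalPhysics.QuantumFieldTheory.Balaban1983to89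
open Literature.MathematicalPhysics.QuantumFieldTheory.Balaban1983to89.T3ContinuumYM3Torus
open Literature.MathematicalPhysics.QuantumFieldTheory.Balaban1983to89.T3UnitScaleTilt
open Literature.MathematicalPhysics.QuantumFieldTheory.Balaban1983to89.T3UnitLawDensityEML
open Literature.MathematicalPhysics.QuantumFieldTheory.Balaban1983to89.T3FinestHeightTail (beta_mul_θBal_sq)
open Literature.MathematicalPhysics.QuantumFieldTheory.Balaban1983to89.T3MinimiserStabilityReduction (θBal_pos)
open Summit.QuantumFields.YangMills.Theorems.LargeFieldMassRefinementTailSubGaussianRung (measurable_dist1_iter)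
open Summit.QuantumFields.YangMills.Theorems.CoarseStiffnessTailHistoryTailOfStiffness (measurable_capSum capSum_mem)
open Summit.QuantumFields.YangMills.Theorems.CoarseStiffnessTailLargeFieldCount (measurable_count count_mem)
open Summit.QuantumFields.YangMills.Theorems.CoarseStiffnessTailLargeFieldCountGlue (historyTailL_of_largeFieldCount)
open Summit.QuantumFields.YangMills.Theorems.CoarseStiffnessTailEdgeBulk

/-! ## §3 Statement level: the crux ⇔ SubThresholdStiffness ∧ UniformLargeFieldCount (all written out, the crux's quantifier block) -/

section Statements

/-- **THE CRUX ⇒ UniformLargeFieldCount** (same constants): `CappedCoarseStiffnessL` implies the large-field COUNT bound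
`∫ exp(c₀·p(g_{K−j})²·N_j) dGibbs_K ≤ exp(C₀·#Plaq_j)` with `(c₀, C₀, γ₁)` uniform in `(F, γ, K, j)` — g5's `integral_exp_count_le` level by
level.  (g5's LargeFieldCount is the same with constants per `(F, γ)` and an `A·log β` allowance; §4.) [cite: Balaban1985UV3, (71) p.273] -/
theorem uniformLargeFieldCount_of_cappedCoarseStiffnessL
    (h : Summit.QuantumFields.YangMills.Theses.CoarseStiffnessTail.CappedCoarseStiffnessL) :
    ∀ (L : ℕ) (b₀ p₀ : ℝ), 0 < b₀ → 2 < p₀ → ∃ (c₀ C₀ γ₁ : ℝ), 0 < c₀ ∧ 0 < γ₁ ∧ γ₁ ≤ 1 ∧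
      ∀ (F : T3Family) (γ : ℝ), F.L = L → 0 < γ → γ ≤ γ₁ → ∀ (K j : ℕ), j ≤ K →
        ∫ U, Real.exp (c₀ * B10.pFun b₀ p₀ (Real.sqrt (γ * ((F.L : ℝ)⁻¹) ^ (K - j))) ^ 2 *
            ∑ a : Plaq (F.P K) j, (if T3UnitScaleTilt.θBal F.L γ b₀ p₀ (K - j) ≤ GaugeGroup.dist1 (GaugeField.plaqHol
              (Averaging.iter (fun i => BlockAveraging.blockAvg (P := F.P K) (j := i) T3UnitLawDensityEML.ℰp) j U) a)
              then (1 : ℝ) else 0)) ∂(T3UnitScaleTilt.gibbsK F T3UnitLawDensityEML.ℰp γ K) ≤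
          Real.exp (C₀ * (Fintype.card (Plaq (F.P K) j) : ℝ)) := by
  intro L b₀ p₀ hb₀ hp₀
  obtain ⟨c₀, C₀, γ₁, hc₀, hγ₁, hγ₁1, hb⟩ := h L b₀ p₀ hb₀ hp₀
  refine ⟨c₀, C₀, γ₁, hc₀, hγ₁, hγ₁1, fun F γ hFL hγ hγγ₁ K j hjK => ?_⟩
  exact (CoarseStiffnessTailLargeFieldCount.integral_exp_count_le F hγ (hγγ₁.trans hγ₁1) hb₀ hc₀.le K j).trans
    (hb F γ hFL hγ hγγ₁ K j hjK)

/-- **THE CRUX ⇒ SubThresholdStiffness** (same constants): `CappedCoarseStiffnessL` implies the BULK bound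
`∫ exp(c₀·β_{K−j}·Y_j) dGibbs_K ≤ exp(C₀·#Plaq_j)`, `Y_j = Σ_a |Ū^j(∂a) − 1|²·1[|Ū^j(∂a) − 1| < θ(K−j)]`, uniformly — §2 `integral_exp_bulk_le`
level by level. [cite: Balaban1985UV3, (5) p.256] -/
theorem subThresholdStiffness_of_cappedCoarseStiffnessL
    (h : Summit.QuantumFields.YangMills.Theses.CoarseStiffnessTail.CappedCoarseStiffnessL) :
    ∀ (L : ℕ) (b₀ p₀ : ℝ), 0 < b₀ → 2 < p₀ → ∃ (c₀ C₀ γ₁ : ℝ), 0 < c₀ ∧ 0 < γ₁ ∧ γ₁ ≤ 1 ∧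
      ∀ (F : T3Family) (γ : ℝ), F.L = L → 0 < γ → γ ≤ γ₁ → ∀ (K j : ℕ), j ≤ K →
        ∫ U, Real.exp (c₀ * (γ * ((F.L : ℝ)⁻¹) ^ (K - j))⁻¹ *
            ∑ a : Plaq (F.P K) j, (if GaugeGroup.dist1 (GaugeField.plaqHol
              (Averaging.iter (fun i => BlockAveraging.blockAvg (P := F.P K) (j := i) T3UnitLawDensityEML.ℰp) j U) a) <
                T3UnitScaleTilt.θBal F.L γ b₀ p₀ (K - j) then
              GaugeGroup.dist1 (GaugeField.plaqHol
                (Averaging.iter (fun i => BlockAveraging.blockAvg (P := F.P K) (j := i) T3UnitLawDensityEML.ℰp) j U) a) ^ 2 else 0))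
            ∂(T3UnitScaleTilt.gibbsK F T3UnitLawDensityEML.ℰp γ K) ≤
          Real.exp (C₀ * (Fintype.card (Plaq (F.P K) j) : ℝ)) := by
  intro L b₀ p₀ hb₀ hp₀
  obtain ⟨c₀, C₀, γ₁, hc₀, hγ₁, hγ₁1, hb⟩ := h L b₀ p₀ hb₀ hp₀
  refine ⟨c₀, C₀, γ₁, hc₀, hγ₁, hγ₁1, fun F γ hFL hγ hγγ₁ K j hjK => ?_⟩
  have hβ0 : 0 ≤ (γ * ((F.L : ℝ)⁻¹) ^ (K - j))⁻¹ := (beta_pos F hγ (K - j)).le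
  exact (integral_exp_bulk_le F hγ.le hc₀.le hβ0 K j (T3UnitScaleTilt.θBal F.L γ b₀ p₀ (K - j))).trans
    (hb F γ hFL hγ hγγ₁ K j hjK)

/-- **SubThresholdStiffness ∧ UniformLargeFieldCount ⇒ THE CRUX** (`c₀ = min(c₁, c₂)/2`, `C₀ = max C₁ C₂`, `γ₁ = min`): by §2
`integral_exp_capSum_le_half_add`, monotonicity in the tilt parameter (`Y_j, N_j ≥ 0`) and `½(e^{A} + e^{B}) ≤ e^{max A B}`.  The BULK hypothesis is
Bałaban's small-field fluctuation control ((5) p.256 two-sided, positive quadratic form), the EDGE hypothesis his large-field factors ((71) p.273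
summed over all large-field sets) — separate mechanisms, separately registered stubs of this line's skeleton v4; both OPEN.
[cite: Balaban1985UV3, (5) p.256 and (71) p.273] -/
theorem cappedCoarseStiffnessL_of_subThreshold_and_uniformCount
    (hSub : ∀ (L : ℕ) (b₀ p₀ : ℝ), 0 < b₀ → 2 < p₀ → ∃ (c₀ C₀ γ₁ : ℝ), 0 < c₀ ∧ 0 < γ₁ ∧ γ₁ ≤ 1 ∧
      ∀ (F : T3Family) (γ : ℝ), F.L = L → 0 < γ → γ ≤ γ₁ → ∀ (K j : ℕ), j ≤ K →
        ∫ U, Real.exp (c₀ * (γ * ((F.L : ℝ)⁻¹) ^ (K - j))⁻¹ *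
            ∑ a : Plaq (F.P K) j, (if GaugeGroup.dist1 (GaugeField.plaqHol
              (Averaging.iter (fun i => BlockAveraging.blockAvg (P := F.P K) (j := i) T3UnitLawDensityEML.ℰp) j U) a) <
                T3UnitScaleTilt.θBal F.L γ b₀ p₀ (K - j) then
              GaugeGroup.dist1 (GaugeField.plaqHol
                (Averaging.iter (fun i => BlockAveraging.blockAvg (P := F.P K) (j := i) T3UnitLawDensityEML.ℰp) j U) a) ^ 2 else 0))
            ∂(T3UnitScaleTilt.gibbsK F T3UnitLawDensityEML.ℰp γ K) ≤
          Real.exp (C₀ * (Fintype.card (Plaq (F.P K) j) : ℝ)))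
    (hCount : ∀ (L : ℕ) (b₀ p₀ : ℝ), 0 < b₀ → 2 < p₀ → ∃ (c₀ C₀ γ₁ : ℝ), 0 < c₀ ∧ 0 < γ₁ ∧ γ₁ ≤ 1 ∧
      ∀ (F : T3Family) (γ : ℝ), F.L = L → 0 < γ → γ ≤ γ₁ → ∀ (K j : ℕ), j ≤ K →
        ∫ U, Real.exp (c₀ * B10.pFun b₀ p₀ (Real.sqrt (γ * ((F.L : ℝ)⁻¹) ^ (K - j))) ^ 2 *
            ∑ a : Plaq (F.P K) j, (if T3UnitScaleTilt.θBal F.L γ b₀ p₀ (K - j) ≤ GaugeGroup.dist1 (GaugeField.plaqHol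
              (Averaging.iter (fun i => BlockAveraging.blockAvg (P := F.P K) (j := i) T3UnitLawDensityEML.ℰp) j U) a)
              then (1 : ℝ) else 0)) ∂(T3UnitScaleTilt.gibbsK F T3UnitLawDensityEML.ℰp γ K) ≤
          Real.exp (C₀ * (Fintype.card (Plaq (F.P K) j) : ℝ))) :
    Summit.QuantumFields.YangMills.Theses.CoarseStiffnessTail.CappedCoarseStiffnessL := by
  intro L b₀ p₀ hb₀ hp₀
  obtain ⟨c₁, C₁, γ₁, hc₁, hγ₁, hγ₁1, hS⟩ := hSub L b₀ p₀ hb₀ hp₀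
  obtain ⟨c₂, C₂, γ₂, hc₂, hγ₂, hγ₂1, hN⟩ := hCount L b₀ p₀ hb₀ hp₀
  refine ⟨min c₁ c₂ / 2, max C₁ C₂, min γ₁ γ₂, half_pos (lt_min hc₁ hc₂), lt_min hγ₁ hγ₂, (min_le_left _ _).trans hγ₁1,
    fun F γ hFL hγ hγγ K j hjK => ?_⟩
  have hγγ₁ : γ ≤ γ₁ := hγγ.trans (min_le_left _ _)
  have hγγ₂ : γ ≤ γ₂ := hγγ.trans (min_le_right _ _)
  have hγ1 : γ ≤ 1 := hγγ₁.trans hγ₁1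
  haveI := isProbabilityMeasure_gibbsK F ℰp hγ.le K
  set c : ℝ := min c₁ c₂ / 2 with hcdef
  have hc0 : 0 ≤ c := (half_pos (lt_min hc₁ hc₂)).le
  have h2c₁ : 2 * c ≤ c₁ := by rw [hcdef]; linarith [min_le_left c₁ c₂]
  have h2c₂ : 2 * c ≤ c₂ := by rw [hcdef]; linarith [min_le_right c₁ c₂]
  set θ : ℝ := θBal F.L γ b₀ p₀ (K - j) with hθdef
  set β : ℝ := (γ * ((F.L : ℝ)⁻¹) ^ (K - j))⁻¹ with hβdef
  have hβ0 : 0 < β := beta_pos F hγ (K - j)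
  set P : ℝ := B10.pFun b₀ p₀ (Real.sqrt (γ * ((F.L : ℝ)⁻¹) ^ (K - j))) ^ 2 with hPdef
  have hP0 : 0 ≤ P := sq_nonneg _
  set card : ℝ := (Fintype.card (Plaq (F.P K) j) : ℝ) with hcarddef
  have hcard0 : 0 ≤ card := Nat.cast_nonneg _
  -- abbreviations for the observables
  set Y : GaugeField (F.P K) 0 (Matrix.specialUnitaryGroup (Fin 2) ℂ) → ℝ := fun U =>
    ∑ a : Plaq (F.P K) j, (if GaugeGroup.dist1 (GaugeField.plaqHol
      (Averaging.iter (fun i => BlockAveraging.blockAvg (P := F.P K) (j := i) ℰp) j U) a) < θ then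
      GaugeGroup.dist1 (GaugeField.plaqHol
        (Averaging.iter (fun i => BlockAveraging.blockAvg (P := F.P K) (j := i) ℰp) j U) a) ^ 2 else 0) with hYdef
  set N : GaugeField (F.P K) 0 (Matrix.specialUnitaryGroup (Fin 2) ℂ) → ℝ := fun U =>
    ∑ a : Plaq (F.P K) j, (if θ ≤ GaugeGroup.dist1 (GaugeField.plaqHol
      (Averaging.iter (fun i => BlockAveraging.blockAvg (P := F.P K) (j := i) ℰp) j U) a) then (1 : ℝ) else 0) with hNdef
  -- the two hypotheses at this pair, and monotonicity in the tilt parameter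
  have hSK : ∫ U, Real.exp (c₁ * β * Y U) ∂(gibbsK F ℰp γ K) ≤ Real.exp (C₁ * card) := by
    have h := hS F γ hFL hγ hγγ₁ K j hjK
    simpa only [hYdef, mul_assoc] using h
  have hNK : ∫ U, Real.exp (c₂ * P * N U) ∂(gibbsK F ℰp γ K) ≤ Real.exp (C₂ * card) := by
    have h := hN F γ hFL hγ hγγ₂ K j hjK
    simpa only [hNdef, hPdef] using h
  have hY0 : ∀ U, 0 ≤ Y U := fun U => (bulkSum_mem F K j θ U).1
  have hN0 : ∀ U, 0 ≤ N U := fun U => (count_mem F K j θ U).1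
  have hmonoY : ∫ U, Real.exp (2 * c * β * Y U) ∂(gibbsK F ℰp γ K) ≤ ∫ U, Real.exp (c₁ * β * Y U) ∂(gibbsK F ℰp γ K) := by
    have hint : Integrable (fun U => Real.exp (c₁ * β * Y U)) (gibbsK F ℰp γ K) := by
      have h := integrable_exp_bulk F hγ.le K j θ (mul_nonneg hc₁.le hβ0.le)
      simpa only [hYdef] using h
    refine integral_mono_of_nonneg (ae_of_all _ fun U => (Real.exp_pos _).le) hint (ae_of_all _ fun U => ?_)
    exact Real.exp_le_exp.mpr (mul_le_mul_of_nonneg_right (mul_le_mul_of_nonneg_right h2c₁ hβ0.le) (hY0 U))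
  have hmonoN : ∫ U, Real.exp (2 * c * P * N U) ∂(gibbsK F ℰp γ K) ≤ ∫ U, Real.exp (c₂ * P * N U) ∂(gibbsK F ℰp γ K) := by
    have hint : Integrable (fun U => Real.exp (c₂ * P * N U)) (gibbsK F ℰp γ K) := by
      have h := integrable_exp_count F hγ.le K j θ (mul_nonneg hc₂.le hP0)
      simpa only [hNdef] using h
    refine integral_mono_of_nonneg (ae_of_all _ fun U => (Real.exp_pos _).le) hint (ae_of_all _ fun U => ?_)
    exact Real.exp_le_exp.mpr (mul_le_mul_of_nonneg_right (mul_le_mul_of_nonneg_right h2c₂ hP0) (hN0 U))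
  -- the split
  have hsplit := integral_exp_capSum_le_half_add F (p₀ := p₀) hγ hγ1 hb₀ hc0 K j
  have hA : Real.exp (C₁ * card) ≤ Real.exp (max C₁ C₂ * card) :=
    Real.exp_le_exp.mpr (mul_le_mul_of_nonneg_right (le_max_left _ _) hcard0)
  have hB : Real.exp (C₂ * card) ≤ Real.exp (max C₁ C₂ * card) :=
    Real.exp_le_exp.mpr (mul_le_mul_of_nonneg_right (le_max_right _ _) hcard0)
  calc ∫ U, Real.exp (c * β * ∑ a : Plaq (F.P K) j, min (GaugeGroup.dist1 (GaugeField.plaqHol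
          (Averaging.iter (fun i => BlockAveraging.blockAvg (P := F.P K) (j := i) ℰp) j U) a) ^ 2) (θ ^ 2)) ∂(gibbsK F ℰp γ K)
      ≤ (1 / 2) * ∫ U, Real.exp (2 * c * β * Y U) ∂(gibbsK F ℰp γ K) +
          (1 / 2) * ∫ U, Real.exp (2 * c * P * N U) ∂(gibbsK F ℰp γ K) := by
        simpa only [hYdef, hNdef, hPdef, hθdef, hβdef] using hsplit
    _ ≤ (1 / 2) * Real.exp (C₁ * card) + (1 / 2) * Real.exp (C₂ * card) := by
        have h1 := hmonoY.trans hSK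
        have h2 := hmonoN.trans hNK
        linarith
    _ ≤ Real.exp (max C₁ C₂ * card) := by linarith

/-- **THE EXACT FACTORISATION OF THE TYPED CRUX**: `CappedCoarseStiffnessL ⇔ SubThresholdStiffness ∧ UniformLargeFieldCount` — the BULK
(joint Gaussian small-field fluctuation control of the averaged plaquettes, large plaquettes uncharged) and the EDGE (the exponential moment of
the large-field count = joint Peierls bounds for all subfamilies, p635820 §3), both in the crux's uniform quantifier block; no interaction term.
Only the second conjunct is read by any consumer of this line (§4). [cite: Balaban1985UV3, (5) p.256 and (71) p.273] -/
theorem cappedCoarseStiffnessL_iff_subThreshold_and_uniformCount :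
    Summit.QuantumFields.YangMills.Theses.CoarseStiffnessTail.CappedCoarseStiffnessL ↔
      ((∀ (L : ℕ) (b₀ p₀ : ℝ), 0 < b₀ → 2 < p₀ → ∃ (c₀ C₀ γ₁ : ℝ), 0 < c₀ ∧ 0 < γ₁ ∧ γ₁ ≤ 1 ∧
        ∀ (F : T3Family) (γ : ℝ), F.L = L → 0 < γ → γ ≤ γ₁ → ∀ (K j : ℕ), j ≤ K →
          ∫ U, Real.exp (c₀ * (γ * ((F.L : ℝ)⁻¹) ^ (K - j))⁻¹ *
              ∑ a : Plaq (F.P K) j, (if GaugeGroup.dist1 (GaugeField.plaqHol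
                (Averaging.iter (fun i => BlockAveraging.blockAvg (P := F.P K) (j := i) T3UnitLawDensityEML.ℰp) j U) a) <
                  T3UnitScaleTilt.θBal F.L γ b₀ p₀ (K - j) then
                GaugeGroup.dist1 (GaugeField.plaqHol
                  (Averaging.iter (fun i => BlockAveraging.blockAvg (P := F.P K) (j := i) T3UnitLawDensityEML.ℰp) j U) a) ^ 2 else 0))
              ∂(T3UnitScaleTilt.gibbsK F T3UnitLawDensityEML.ℰp γ K) ≤
            Real.exp (C₀ * (Fintype.card (Plaq (F.P K) j) : ℝ))) ∧
      (∀ (L : ℕ) (b₀ p₀ : ℝ), 0 < b₀ → 2 < p₀ → ∃ (c₀ C₀ γ₁ : ℝ), 0 < c₀ ∧ 0 < γ₁ ∧ γ₁ ≤ 1 ∧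
        ∀ (F : T3Family) (γ : ℝ), F.L = L → 0 < γ → γ ≤ γ₁ → ∀ (K j : ℕ), j ≤ K →
          ∫ U, Real.exp (c₀ * B10.pFun b₀ p₀ (Real.sqrt (γ * ((F.L : ℝ)⁻¹) ^ (K - j))) ^ 2 *
              ∑ a : Plaq (F.P K) j, (if T3UnitScaleTilt.θBal F.L γ b₀ p₀ (K - j) ≤ GaugeGroup.dist1 (GaugeField.plaqHol
                (Averaging.iter (fun i => BlockAveraging.blockAvg (P := F.P K) (j := i) T3UnitLawDensityEML.ℰp) j U) a)
                then (1 : ℝ) else 0)) ∂(T3UnitScaleTilt.gibbsK F T3UnitLawDensityEML.ℰp γ K) ≤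
            Real.exp (C₀ * (Fintype.card (Plaq (F.P K) j) : ℝ)))) :=
  ⟨fun h => ⟨subThresholdStiffness_of_cappedCoarseStiffnessL h, uniformLargeFieldCount_of_cappedCoarseStiffnessL h⟩,
    fun h => cappedCoarseStiffnessL_of_subThreshold_and_uniformCount h.1 h.2⟩

end Statements

/-! ## §4 The edge conjunct alone feeds the consumers of the line, by name -/

section Consumers

/-- **UniformLargeFieldCount ⇒ LargeFieldCount** (g5's hypothesis of `historyTailL_of_largeFieldCount`: constants per `(F, γ)`, logarithmic
allowance `A·log β`; here `A = 0` and the constants do not even depend on `(F, γ)`) — requantification only. [cite: Balaban1985UV3, (71) p.273] -/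
theorem largeFieldCount_of_uniformLargeFieldCount
    (hCount : ∀ (L : ℕ) (b₀ p₀ : ℝ), 0 < b₀ → 2 < p₀ → ∃ (c₀ C₀ γ₁ : ℝ), 0 < c₀ ∧ 0 < γ₁ ∧ γ₁ ≤ 1 ∧
      ∀ (F : T3Family) (γ : ℝ), F.L = L → 0 < γ → γ ≤ γ₁ → ∀ (K j : ℕ), j ≤ K →
        ∫ U, Real.exp (c₀ * B10.pFun b₀ p₀ (Real.sqrt (γ * ((F.L : ℝ)⁻¹) ^ (K - j))) ^ 2 *
            ∑ a : Plaq (F.P K) j, (if T3UnitScaleTilt.θBal F.L γ b₀ p₀ (K - j) ≤ GaugeGroup.dist1 (GaugeField.plaqHol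
              (Averaging.iter (fun i => BlockAveraging.blockAvg (P := F.P K) (j := i) T3UnitLawDensityEML.ℰp) j U) a)
              then (1 : ℝ) else 0)) ∂(T3UnitScaleTilt.gibbsK F T3UnitLawDensityEML.ℰp γ K) ≤
          Real.exp (C₀ * (Fintype.card (Plaq (F.P K) j) : ℝ))) :
    ∀ (L : ℕ) (b₀ p₀ : ℝ), 0 < b₀ → 2 < p₀ → ∃ γ₁ : ℝ, 0 < γ₁ ∧ γ₁ ≤ 1 ∧
      ∀ (F : T3Family) (γ : ℝ), F.L = L → 0 < γ → γ ≤ γ₁ → ∃ (c₀ C₀ : ℝ) (A : ℕ), 0 < c₀ ∧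
        ∀ (K j : ℕ), j ≤ K →
          ∫ U, Real.exp (c₀ * B10.pFun b₀ p₀ (Real.sqrt (γ * ((F.L : ℝ)⁻¹) ^ (K - j))) ^ 2 *
              ∑ a : Plaq (F.P K) j, (if T3UnitScaleTilt.θBal F.L γ b₀ p₀ (K - j) ≤ GaugeGroup.dist1 (GaugeField.plaqHol
                (Averaging.iter (fun i => BlockAveraging.blockAvg (P := F.P K) (j := i) T3UnitLawDensityEML.ℰp) j U) a)
                then (1 : ℝ) else 0)) ∂(T3UnitScaleTilt.gibbsK F T3UnitLawDensityEML.ℰp γ K) ≤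
            Real.exp ((C₀ + A * Real.log ((γ * ((F.L : ℝ)⁻¹) ^ (K - j))⁻¹)) * (Fintype.card (Plaq (F.P K) j) : ℝ)) := by
  intro L b₀ p₀ hb₀ hp₀
  obtain ⟨c₀, C₀, γ₁, hc₀, hγ₁, hγ₁1, hN⟩ := hCount L b₀ p₀ hb₀ hp₀
  refine ⟨γ₁, hγ₁, hγ₁1, fun F γ hFL hγ hγγ₁ => ⟨c₀, C₀, 0, hc₀, fun K j hjK => ?_⟩⟩
  have h := hN F γ hFL hγ hγγ₁ K j hjK
  simpa only [Nat.cast_zero, zero_mul, add_zero] using h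

/-- **UniformLargeFieldCount ⇒ `UnitScaleTilt.HistoryTailL`** (crux stmt-QuantumFields-19936 of the parent route, BY NAME): §4 requantification
fed to g5's `historyTailL_of_largeFieldCount` (p636229).  Conditional certificate; the hypothesis is OPEN. [cite: Balaban1985UV3, (71) p.273] -/
theorem historyTailL_of_uniformLargeFieldCount
    (hCount : ∀ (L : ℕ) (b₀ p₀ : ℝ), 0 < b₀ → 2 < p₀ → ∃ (c₀ C₀ γ₁ : ℝ), 0 < c₀ ∧ 0 < γ₁ ∧ γ₁ ≤ 1 ∧
      ∀ (F : T3Family) (γ : ℝ), F.L = L → 0 < γ → γ ≤ γ₁ → ∀ (K j : ℕ), j ≤ K →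
        ∫ U, Real.exp (c₀ * B10.pFun b₀ p₀ (Real.sqrt (γ * ((F.L : ℝ)⁻¹) ^ (K - j))) ^ 2 *
            ∑ a : Plaq (F.P K) j, (if T3UnitScaleTilt.θBal F.L γ b₀ p₀ (K - j) ≤ GaugeGroup.dist1 (GaugeField.plaqHol
              (Averaging.iter (fun i => BlockAveraging.blockAvg (P := F.P K) (j := i) T3UnitLawDensityEML.ℰp) j U) a)
              then (1 : ℝ) else 0)) ∂(T3UnitScaleTilt.gibbsK F T3UnitLawDensityEML.ℰp γ K) ≤
          Real.exp (C₀ * (Fintype.card (Plaq (F.P K) j) : ℝ))) :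
    Summit.QuantumFields.YangMills.Theses.UnitScaleTilt.HistoryTailL :=
  historyTailL_of_largeFieldCount (largeFieldCount_of_uniformLargeFieldCount hCount)

end Consumers

end Summit.QuantumFields.YangMills.Theorems.CoarseStiffnessTailEdgeBulkFactorisation

end
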